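import Literature.Computability.Cryptography.RegevSamplerMachine
import Literature.Computability.Cryptography.RegevSamplerDualSize
import HarnessLib

/-!
# Regev 2009, Lemma 3.14: the rounding-error size `Y` is exponentially small for `ℓ_R ≥ |code B|(2|code B|+2) + j`

Topic `Computability/Cryptography`; sequel of `RegevSamplerMachine.lean` (`Ysz = t · 2^{-ℓ_R} · Σᵢ ‖b∨ᵢ‖`) and
`RegevSamplerDualSize.lean` (`sum_norm_dualVec_le_nat : Σᵢ ‖b∨ᵢ‖ ≤ n²·n!·2^{n|code B|}`). For the parameter
discharge of the machine bound (the hypothesis `Y ≤ m^c 2^{-m}` of `RegevSamplerSlack.exists_negligible_slack_le`)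
one needs the dual-basis size as a clean power of two in the LENGTH OF THE INSTANCE CODE `e = |code B|` (so that a
register length `ℓ_R` polynomial in the input length absorbs it):

* `dualSize_le_two_pow` — `n²·n!·(2^e)^n ≤ 2^{e(2e+2)}` (ℕ);
* `sum_norm_dualVec_le_two_pow_length` — `Σᵢ ‖b∨ᵢ‖ ≤ 2^{e(2e+2)}`;
* **`Ysz_le_of_le_ℓR`** — if `e(2e+2) + j ≤ ℓ_R` and `0 ≤ t` then `Y ≤ t · 2^{-j}`.

Everything is proved; no named fact is introduced.

## References

* O. Regev, *On lattices, learning with errors, random linear codes, and cryptography*, J. ACM 56 (2009), art. 34,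
  Lemma 3.14 (proof: rounding to `R⁻¹ L`, "R a large power of two"), Lemma 3.12 (proof) [Regev2009].
* D. Micciancio, S. Goldwasser, *Complexity of Lattice Problems*, Kluwer 2002, Ch. 1 §1.2 (size of the dual basis,
  Cramer's rule) [MicciancioGoldwasser2002].
-/

noncomputable section

namespace Literature.Computability.Cryptography

namespace Regev2009

namespace SamplerRegs

open Literature.Algebra.EuclideanLattices Literature.Algebra.EuclideanLattices.Regev2009 Peikert2009 Finset

/-- **`n²·n!·(2^e)^n ≤ 2^{e(2e+2)}` when `n ≤ e`.** [cite: MicciancioGoldwasser2002, Ch. 1 §1.2] -/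
theorem dualSize_le_two_pow {n e : ℕ} (hne : n ≤ e) : n * n * (n.factorial * (2 ^ e) ^ n) ≤ 2 ^ (e * (2 * e + 2)) := by
  have hn2 : n ≤ 2 ^ e := (Nat.lt_two_pow_self).le.trans (Nat.pow_le_pow_right (by norm_num) hne)
  have hfac : n.factorial ≤ 2 ^ (e * e) :=
    calc n.factorial ≤ n ^ n := Nat.factorial_le_pow n
      _ ≤ (2 ^ e) ^ n := Nat.pow_le_pow_left hn2 n
      _ = 2 ^ (e * n) := by rw [← pow_mul]
      _ ≤ 2 ^ (e * e) := Nat.pow_le_pow_right (by norm_num) (Nat.mul_le_mul_left e hne)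
  have hpow : (2 ^ e) ^ n ≤ 2 ^ (e * e) := by
    rw [← pow_mul]; exact Nat.pow_le_pow_right (by norm_num) (Nat.mul_le_mul_left e hne)
  calc n * n * (n.factorial * (2 ^ e) ^ n) ≤ 2 ^ e * 2 ^ e * (2 ^ (e * e) * 2 ^ (e * e)) :=
        Nat.mul_le_mul (Nat.mul_le_mul hn2 hn2) (Nat.mul_le_mul hfac hpow)
    _ = 2 ^ (e * (2 * e + 2)) := by rw [← pow_add, ← pow_add, ← pow_add]; congr 1; ring

variable {W : ℕ} (I : LatticeInstance) [IsZLattice ℝ I.lattice]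

/-- **`Σᵢ ‖b∨ᵢ‖ ≤ 2^{e(2e+2)}`**, `e = |code B|`. [cite: Regev2009, Lemma 3.14 (proof)] [cite: MicciancioGoldwasser2002, Ch. 1 §1.2] -/
theorem sum_norm_dualVec_le_two_pow_length :
    ∑ i, ‖dualVec I i‖ ≤ (2 : ℝ) ^ (I.encode.length * (2 * I.encode.length + 2)) := by
  refine (SamplerArith.sum_norm_dualVec_le_nat I).trans ?_
  exact_mod_cast dualSize_le_two_pow (RegevRoutine.n_le_length_encode I)

variable (Λ : SamplerClassical.Layout W I.n)

/-- **`Y ≤ t · 2^{-j}` once `ℓ_R ≥ e(2e+2) + j`.** [cite: Regev2009, Lemma 3.14 (proof)] -/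
theorem Ysz_le_of_le_ℓR {t : ℝ} (ht : 0 ≤ t) {j : ℕ}
    (hℓR : I.encode.length * (2 * I.encode.length + 2) + j ≤ Λ.ℓR) : Ysz I Λ t ≤ t * (2⁻¹ : ℝ) ^ j := by
  set E := I.encode.length * (2 * I.encode.length + 2) with hE
  have hS := sum_norm_dualVec_le_two_pow_length I
  rw [← hE] at hS
  have hR : (((2 ^ Λ.ℓR : ℕ) : ℝ))⁻¹ ≤ ((2 : ℝ) ^ (E + j))⁻¹ := by
    rw [Nat.cast_pow, Nat.cast_ofNat]
    exact inv_anti₀ (by positivity) (pow_le_pow_right₀ one_le_two hℓR)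
  calc Ysz I Λ t = t * ((((2 ^ Λ.ℓR : ℕ) : ℝ))⁻¹ * ∑ i, ‖dualVec I i‖) := by rw [Ysz, mul_assoc]
    _ ≤ t * (((2 : ℝ) ^ (E + j))⁻¹ * (2 : ℝ) ^ E) :=
        mul_le_mul_of_nonneg_left (mul_le_mul hR hS (sum_nonneg fun i _ => norm_nonneg _) (by positivity)) ht
    _ = t * (2⁻¹ : ℝ) ^ j := by
        rw [pow_add, mul_inv, mul_assoc, mul_comm ((2 : ℝ) ^ j)⁻¹ ((2 : ℝ) ^ E), ← mul_assoc ((2 : ℝ) ^ E)⁻¹,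
          inv_mul_cancel₀ (by positivity : (2 : ℝ) ^ E ≠ 0), one_mul, inv_pow]

/-- `0 ≤ Y` for `0 ≤ t`. [folklore] -/
theorem Ysz_nonneg {t : ℝ} (ht : 0 ≤ t) : 0 ≤ Ysz I Λ t := by
  rw [Ysz]
  exact mul_nonneg (mul_nonneg ht (by positivity)) (sum_nonneg fun i _ => norm_nonneg _)

end SamplerRegs

end Regev2009

end Literature.Computability.Cryptography

end
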